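import Summits.Ventures.PercRepro.SevenThreeCoreFinal

/-!
# PercRepro — the `(7,3)` cell: C-025 at `q = 3` on every finite matroid (p3, gen 17)

The end of the `q = 3` row as ONE kernel statement: night-3's reduction `c025_three_of_seven`
(`RLSRuleSixClassify.lean`: C-025 at `q = 3` for every finite matroid and every `p ≥ 5` follows from the `(7,3)` core
alone, via `R₃⁺` per flat on the core's planes for `p ≥ 8` and the `(8,3)`-to-`(7,3)` reductions) fed with the `(7,3)`
core theorem `rls_seven_three_of_core` (`SevenThreeCoreFinal.lean`: Theorem P₁(7,3) + the bridge + the per-plane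
inequality on the positive-type planes of a core matroid).  `rls_seven_three_of_core` carries a `DecidableEq` instance
(the cell's `Finset` bookkeeping); the reduction's hypothesis does not, so the instance is supplied classically —
`ThmN.RLS M 7 3` is the same proposition either way.  Axioms: standard.
-/

namespace PercRepro

namespace SevenThree

/-- **C-025 at `q = 3` on every finite matroid, every `p ≥ 5`**: `ThmN.RLS M p 3` for every finite matroid `M` and
every `p ≥ 5` — the `(7,3)` core theorem (`rls_seven_three_of_core`) fed to night-3's reduction
(`NightThree.c025_three_of_seven`). -/
theorem c025_three_all {β : Type} (M : Matroid β) [M.Finite] (p : ℕ) (hp : 5 ≤ p) : ThmN.RLS M p 3 :=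
  NightThree.c025_three_of_seven (fun M _ hc => by classical exact rls_seven_three_of_core hc) M p hp

end SevenThree

end PercRepro
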